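import Literature.Analysis.FluidPDE.StationaryEulerStep
import Literature.Analysis.FluidPDE.ConvexIntegration2DIteration
import Literature.Analysis.FunctionSpaces.TorusSobolevNormFacts
import HarnessLib

/-!
# The convex-integration iteration on the torus (Choffrut–Székelyhidi 2014, §2, Step 3)

Topic `Literature/Analysis/FluidPDE`. Support file of the proof of
`Literature.Analysis.FluidPDE.Torus.ChoffrutSzekelyhidi2014_thm1` (Choffrut–Székelyhidi, SIAM
J. Math. Anal. 46 (2014) = arXiv:1401.4301). The paper concludes by the Baire category argument
(continuity points of `w ↦ ∫ |w|²` on the weak closure `X` of `X₀`); here, as in the tree's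
`ConvexIntegration2DIteration*` files, the same ingredients are run as an explicit iteration
`w_{k+1} = w_k + W_k` with the increments `W_k` of `StationaryEuler.step` (tolerance
`ε_k = θ 2^{-(k+1)}`), nearly orthogonal to all previous states:

* the states stay in `X₀` and are uniformly bounded (`norm_state_le`);
* energies `E_k = ‖w_k‖²_{L²}` and corrected energies `F_k = E_k + 2 Σ_{i<k} ε_i` (monotone,
  bounded), whence `‖w_m - w_n‖²_{L²} ≤ F_m - F_n` and the **`L²` Cauchy property** (`cauchy`);
* the **defects are summable**, `Σ_k J(w_k) ≤ R² + 3θ`, hence `J(w_k) → 0` (`tendsto_J`);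
* the accumulated `H⁻¹` distance of the velocities from `v₀` stays below `θ`
  (`eSobolevNorm_vel_state_sub_le`).

## References

* A. Choffrut, L. Székelyhidi Jr., SIAM J. Math. Anal. 46 (2014), §2, Step 3.
* L. Székelyhidi Jr., *From isometric embeddings to turbulence*, Lecture notes (2012), §5–6
  (the explicit iteration replacing Baire category).
-/

noncomputable section

open scoped InnerProductSpace ContDiff ENNReal Topology
open Set Function MeasureTheory Metric Filter
open Literature.Analysis.FunctionSpaces

namespace Literature.Analysis.FluidPDE

namespace StationaryEuler

variable {d : Type*} [Fintype d] [DecidableEq d] [Nonempty d]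

/-! ## The data of a run -/

/-- The fixed data of one run of the iteration: the relaxed family, the (continuous) energy
profile `e`, the initial state `w₀ ∈ X₀`, and the tolerance `θ > 0`. [cite: ChoffrutSzekelyhidi2014, §2] -/
structure IterData (d : Type*) [Fintype d] [DecidableEq d] [Nonempty d] where
  /-- the relaxed sets -/
  𝓕 : RelaxedFamily d
  /-- the energy profile -/
  e : UnitAddTorus d → ℝ
  /-- the initial state -/
  w₀ : UnitAddTorus d → State d
  /-- the tolerance -/
  θ : ℝ
  he : Continuous e
  hw₀ : MemX0 𝓕 e w₀
  hθ : 0 < θ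

namespace IterData

variable (D : IterData d)

/-- The tolerance at stage `k`: `ε_k = θ 2^{-(k+1)}`. [folklore] -/
def eps (k : ℕ) : ℝ := D.θ / 2 ^ (k + 1)

/-- The tolerances are positive. [folklore] -/
theorem eps_pos (k : ℕ) : 0 < D.eps k := by unfold eps; have := D.hθ; positivity

/-- The tolerances are non-negative. [folklore] -/
theorem eps_nonneg (k : ℕ) : 0 ≤ D.eps k := (D.eps_pos k).le

/-- The tolerances form a geometric sequence. [folklore] -/
theorem eps_eq (k : ℕ) : D.eps k = D.θ / 2 * (1 / 2) ^ k := by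
  rw [eps, one_div, inv_pow, pow_succ]; ring

/-- The tolerances are summable. [folklore] -/
theorem summable_eps : Summable D.eps := by
  rw [show D.eps = fun k => D.θ / 2 * (1 / 2) ^ k from funext D.eps_eq]
  exact (summable_geometric_of_lt_one (by norm_num) (by norm_num)).mul_left _

/-- `∑ ε_k = θ`. [folklore] -/
theorem tsum_eps : ∑' k, D.eps k = D.θ := by
  rw [show D.eps = fun k => D.θ / 2 * (1 / 2) ^ k from funext D.eps_eq, tsum_mul_left,
    tsum_geometric_of_lt_one (by norm_num) (by norm_num)]
  ring

/-- Partial sums of the tolerances are at most `θ`. [folklore] -/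
theorem sum_eps_le (s : Finset ℕ) : ∑ k ∈ s, D.eps k ≤ D.θ := by
  rw [← D.tsum_eps]; exact D.summable_eps.sum_le_tsum s fun k _ => D.eps_nonneg k

/-- Partial sums of the tolerances are below `θ`. [folklore] -/
theorem sum_range_eps_lt (n : ℕ) : ∑ k ∈ Finset.range n, D.eps k < D.θ := by
  have h : ∑ k ∈ Finset.range (n + 1), D.eps k ≤ D.θ := D.sum_eps_le _
  rw [Finset.sum_range_succ] at h
  linarith [D.eps_pos n]

/-! ## The iteration -/

/-- An admissible history: all entries in `X₀`. [folklore] -/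
def HistOK (k : ℕ) (H : Fin (k + 1) → UnitAddTorus d → State d) : Prop := ∀ j, MemX0 D.𝓕 D.e (H j)

/-- The specification of the increment at stage `k` (an instance of `step`, with the previous
states as test fields). [cite: ChoffrutSzekelyhidi2014, §2, Step 3] -/
theorem step_spec (k : ℕ) (H : {H : Fin (k + 1) → UnitAddTorus d → State d // D.HistOK k H}) :
    ∃ W : UnitAddTorus d → State d, Torus.IsSmooth W ∧ IsTorusSub W ∧
      (∀ x, H.1 (Fin.last k) x + W x ∈ D.𝓕.U (D.e x)) ∧
      (∀ j, |∫ x, ⟪W x, H.1 j x⟫_ℝ| ≤ D.eps k) ∧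
      Torus.eSobolevNorm (-1) (EuclideanSpace.complexify ∘ fun x => vel (W x)) ≤ ENNReal.ofReal (D.eps k) ∧
      defect D.e (H.1 (Fin.last k)) - D.eps k ≤ ∫ x, ‖W x‖ ^ 2 :=
  step D.𝓕 D.he (H.2 (Fin.last k)) H.1 (fun j => (H.2 j).continuous) (D.eps_pos k)

/-- **The iteration** (history form). [cite: ChoffrutSzekelyhidi2014, §2, Step 3] -/
def seqAux : (k : ℕ) → {H : Fin (k + 1) → UnitAddTorus d → State d // D.HistOK k H}
  | 0 => ⟨fun _ => D.w₀, fun _ => D.hw₀⟩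
  | k + 1 =>
    ⟨Fin.snoc (α := fun _ => UnitAddTorus d → State d) (seqAux k).1
        (fun x => (seqAux k).1 (Fin.last k) x + Classical.choose (D.step_spec k (seqAux k)) x), by
      intro j
      refine Fin.lastCases ?_ (fun i => ?_) j
      · rw [Fin.snoc_last]
        have hs := Classical.choose_spec (D.step_spec k (seqAux k))
        have hH := (seqAux k).2 (Fin.last k)
        exact ⟨hH.smooth.add hs.1, hH.sub.add hH.smooth hs.1 hs.2.1, hs.2.2.1⟩
      · rw [Fin.snoc_castSucc]
        exact (seqAux k).2 i⟩

/-- The `k`-th state `w_k`. [folklore] -/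
def state (k : ℕ) : UnitAddTorus d → State d := (D.seqAux k).1 (Fin.last k)

/-- The `k`-th increment `W_k`. [folklore] -/
def incr (k : ℕ) : UnitAddTorus d → State d := Classical.choose (D.step_spec k (D.seqAux k))

/-- `w_0 = w₀`. [folklore] -/
theorem state_zero : D.state 0 = D.w₀ := rfl

/-- `w_{k+1} = w_k + W_k`. [folklore] -/
theorem state_succ (k : ℕ) : D.state (k + 1) = fun x => D.state k x + D.incr k x := by
  show (D.seqAux (k + 1)).1 (Fin.last (k + 1)) = _
  simp only [seqAux, Fin.snoc_last]
  rfl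

/-- `w_{k+1}(x) = w_k(x) + W_k(x)`. [folklore] -/
theorem state_succ_apply (k : ℕ) (x : UnitAddTorus d) : D.state (k + 1) x = D.state k x + D.incr k x := by
  rw [D.state_succ]

/-- Earlier entries of the history are the earlier states. [folklore] -/
theorem seqAux_castSucc (k : ℕ) (j : Fin (k + 1)) : (D.seqAux (k + 1)).1 j.castSucc = (D.seqAux k).1 j := by
  show Fin.snoc (α := fun _ => UnitAddTorus d → State d) (D.seqAux k).1 _ j.castSucc = _
  rw [Fin.snoc_castSucc]

/-- The history consists of the states. [folklore] -/
theorem seqAux_eq_state (k : ℕ) (j : Fin (k + 1)) : (D.seqAux k).1 j = D.state j := by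
  induction k with
  | zero => fin_cases j; rfl
  | succ k ih =>
    refine Fin.lastCases ?_ (fun i => ?_) j
    · rfl
    · rw [D.seqAux_castSucc k i, ih i]; rfl

/-- **All states lie in `X₀`.** [cite: ChoffrutSzekelyhidi2014, §2, Step 3] -/
theorem state_memX0 (k : ℕ) : MemX0 D.𝓕 D.e (D.state k) := (D.seqAux k).2 (Fin.last k)

/-- The increments are smooth. [folklore] -/
theorem incr_smooth (k : ℕ) : Torus.IsSmooth (D.incr k) := (Classical.choose_spec (D.step_spec k (D.seqAux k))).1

/-- **Near-orthogonality of the increments to all previous states.** [folklore] -/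
theorem incr_orth_state {k j : ℕ} (hj : j ≤ k) : |∫ x, ⟪D.incr k x, D.state j x⟫_ℝ| ≤ D.eps k := by
  have h := (Classical.choose_spec (D.step_spec k (D.seqAux k))).2.2.2.1 ⟨j, Nat.lt_succ_of_le hj⟩
  simp only [D.seqAux_eq_state] at h
  exact h

/-- **`H⁻¹`-smallness of the velocity increments.** [folklore] -/
theorem incr_hneg (k : ℕ) :
    Torus.eSobolevNorm (-1) (EuclideanSpace.complexify ∘ fun x => vel (D.incr k x)) ≤ ENNReal.ofReal (D.eps k) :=
  (Classical.choose_spec (D.step_spec k (D.seqAux k))).2.2.2.2.1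

/-- **The gain of the increments.** [folklore] -/
theorem incr_gain (k : ℕ) : defect D.e (D.state k) - D.eps k ≤ ∫ x, ‖D.incr k x‖ ^ 2 :=
  (Classical.choose_spec (D.step_spec k (D.seqAux k))).2.2.2.2.2

/-! ## Bounds and energies -/

/-- The states are continuous. [folklore] -/
theorem state_continuous (k : ℕ) : Continuous (D.state k) := (D.state_memX0 k).continuous

/-- The increments are continuous. [folklore] -/
theorem incr_continuous (k : ℕ) : Continuous (D.incr k) := (D.incr_smooth k).continuous

/-- `W_k = w_{k+1} - w_k`. [folklore] -/
theorem incr_eq_sub (k : ℕ) (x : UnitAddTorus d) : D.incr k x = D.state (k + 1) x - D.state k x := by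
  rw [D.state_succ_apply]; abel

/-- The maximum `ē` of the energy profile. [folklore] -/
def ebar : ℝ := ⨆ x, D.e x

/-- `e ≤ ē`. [folklore] -/
theorem e_le_ebar (x : UnitAddTorus d) : D.e x ≤ D.ebar := le_ciSup (isCompact_range D.he).bddAbove x

/-- The uniform bound `R = √ē + 3 ē d` on all states. [cite: ChoffrutSzekelyhidi2014, §2, Step 1] -/
def R : ℝ := Real.sqrt D.ebar + 3 * D.ebar * Fintype.card d

/-- **All states are bounded by `R`.** [cite: ChoffrutSzekelyhidi2014, §2, Step 1] -/
theorem norm_state_le (k : ℕ) (x : UnitAddTorus d) : ‖D.state k x‖ ≤ D.R := (D.state_memX0 k).norm_le D.e_le_ebar x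

/-- `R ≥ 0`. [folklore] -/
theorem R_nonneg : 0 ≤ D.R := by
  obtain ⟨x⟩ : Nonempty (UnitAddTorus d) := inferInstance
  exact (norm_nonneg _).trans (D.norm_state_le 0 x)

/-- The `L²` pairing of state fields. [folklore] -/
def ip (u v : UnitAddTorus d → State d) : ℝ := ∫ x, ⟪u x, v x⟫_ℝ

omit [DecidableEq d] [Nonempty d] in
/-- The pairing is symmetric. [folklore] -/
theorem ip_comm (u v : UnitAddTorus d → State d) : ip u v = ip v u := by
  simp only [ip, real_inner_comm]

omit [DecidableEq d] [Nonempty d] in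
/-- `⟨u, u⟩ = ∫ ‖u‖²`. [folklore] -/
theorem ip_self (u : UnitAddTorus d → State d) : ip u u = ∫ x, ‖u x‖ ^ 2 := by
  simp only [ip, real_inner_self_eq_norm_sq]

omit [DecidableEq d] [Nonempty d] in
/-- `⟨u, u⟩ ≥ 0`. [folklore] -/
theorem ip_self_nonneg (u : UnitAddTorus d → State d) : 0 ≤ ip u u := by
  rw [ip_self]; exact integral_nonneg fun x => by positivity

/-- The energy `E_k = ‖w_k‖²_{L²}`. [folklore] -/
def E (k : ℕ) : ℝ := ip (D.state k) (D.state k)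

/-- `E_{k+1} = E_k + 2⟨w_k, W_k⟩ + ‖W_k‖²`. [folklore] -/
theorem E_succ (k : ℕ) : D.E (k + 1) = D.E k + 2 * ip (D.state k) (D.incr k) + ip (D.incr k) (D.incr k) := by
  simp only [E, ip]
  have h1 : Integrable fun x => ⟪D.state k x, D.state k x⟫_ℝ := ((D.state_continuous k).inner (D.state_continuous k)).integrable_unitAddTorus
  have h2 : Integrable fun x => ⟪D.state k x, D.incr k x⟫_ℝ := ((D.state_continuous k).inner (D.incr_continuous k)).integrable_unitAddTorus
  have h3 : Integrable fun x => ⟪D.incr k x, D.incr k x⟫_ℝ := ((D.incr_continuous k).inner (D.incr_continuous k)).integrable_unitAddTorus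
  have : (fun x => ⟪D.state (k + 1) x, D.state (k + 1) x⟫_ℝ) =
      fun x => ⟪D.state k x, D.state k x⟫_ℝ + 2 * ⟪D.state k x, D.incr k x⟫_ℝ + ⟪D.incr k x, D.incr k x⟫_ℝ := by
    funext x
    rw [D.state_succ_apply, inner_add_left, inner_add_right, inner_add_right, real_inner_comm (D.incr k x) (D.state k x)]
    ring
  have h12 : Integrable fun x => ⟪D.state k x, D.state k x⟫_ℝ + 2 * ⟪D.state k x, D.incr k x⟫_ℝ := h1.add (h2.const_mul 2)
  rw [this, integral_add h12 h3, integral_add h1 (h2.const_mul 2), integral_const_mul]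

/-- `|⟨W_k, w_j⟩| ≤ ε_k` for `j ≤ k`. [folklore] -/
theorem abs_ip_incr_state_le {k j : ℕ} (hj : j ≤ k) : |ip (D.incr k) (D.state j)| ≤ D.eps k := D.incr_orth_state hj

/-- The energies are bounded: `E_k ≤ R²`. [folklore] -/
theorem E_le (k : ℕ) : D.E k ≤ D.R ^ 2 := by
  rw [E, ip_self]
  calc ∫ x, ‖D.state k x‖ ^ 2 ≤ ∫ _ : UnitAddTorus d, D.R ^ 2 := by
        refine integral_mono ((D.state_continuous k).norm.pow 2).integrable_unitAddTorus (integrable_const _) fun x => ?_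
        exact pow_le_pow_left₀ (norm_nonneg _) (D.norm_state_le k x) 2
    _ = D.R ^ 2 := by simp

/-- The corrected energies `F_k = E_k + 2 Σ_{i<k} ε_i`. [folklore] -/
def F (k : ℕ) : ℝ := D.E k + 2 * ∑ i ∈ Finset.range k, D.eps i

/-- The corrected energies are non-decreasing. [folklore] -/
theorem F_monotone : Monotone D.F := by
  refine monotone_nat_of_le_succ fun k => ?_
  simp only [F, Finset.sum_range_succ, D.E_succ]
  have h1 := D.abs_ip_incr_state_le (le_refl k)
  rw [ip_comm] at h1
  have h2 := ip_self_nonneg (D.incr k)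
  have := neg_abs_le (ip (D.state k) (D.incr k))
  linarith

/-- The corrected energies are bounded. [folklore] -/
theorem F_le (k : ℕ) : D.F k ≤ D.R ^ 2 + 2 * D.θ := by
  unfold F; linarith [D.E_le k, D.sum_eps_le (Finset.range k)]

/-- **`‖w_m - w_n‖²_{L²} ≤ F_m - F_n` for `n ≤ m`.** [folklore] -/
theorem ip_sub_le (n m : ℕ) (hnm : n ≤ m) :
    ip (fun x => D.state m x - D.state n x) (fun x => D.state m x - D.state n x) ≤ D.F m - D.F n := by
  have key : ∀ j : ℕ, ip (fun x => D.state (n + j) x - D.state n x) (fun x => D.state (n + j) x - D.state n x) =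
      D.E (n + j) - D.E n - 2 * ∑ k ∈ Finset.range j, ip (D.incr (n + k)) (D.state n) := by
    intro j
    induction j with
    | zero => simp [ip, E]
    | succ j ih =>
      rw [Finset.sum_range_succ, ← add_assoc, D.E_succ (n + j)]
      have hX : ip (fun x => D.state (n + j + 1) x - D.state n x) (fun x => D.state (n + j + 1) x - D.state n x) =
          ip (fun x => D.state (n + j) x - D.state n x) (fun x => D.state (n + j) x - D.state n x) +
            2 * (ip (D.state (n + j)) (D.incr (n + j)) - ip (D.incr (n + j)) (D.state n)) +
            ip (D.incr (n + j)) (D.incr (n + j)) := by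
        simp only [ip]
        set W := D.incr (n + j)
        set a := D.state (n + j)
        set b := D.state n
        have hW : Continuous W := D.incr_continuous _
        have ha : Continuous a := D.state_continuous _
        have hb : Continuous b := D.state_continuous _
        have i1 : Integrable fun x => ⟪a x - b x, a x - b x⟫_ℝ := ((ha.sub hb).inner (ha.sub hb)).integrable_unitAddTorus
        have i2 : Integrable fun x => ⟪a x, W x⟫_ℝ := (ha.inner hW).integrable_unitAddTorus
        have i3 : Integrable fun x => ⟪W x, b x⟫_ℝ := (hW.inner hb).integrable_unitAddTorus
        have i4 : Integrable fun x => ⟪W x, W x⟫_ℝ := (hW.inner hW).integrable_unitAddTorus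
        have : (fun x => ⟪D.state (n + j + 1) x - b x, D.state (n + j + 1) x - b x⟫_ℝ) =
            fun x => ⟪a x - b x, a x - b x⟫_ℝ + 2 * (⟪a x, W x⟫_ℝ - ⟪W x, b x⟫_ℝ) + ⟪W x, W x⟫_ℝ := by
          funext x
          have hs : D.state (n + j + 1) x = a x + W x := D.state_succ_apply (n + j) x
          rw [hs]
          simp only [inner_add_left, inner_add_right, inner_sub_left, inner_sub_right, real_inner_comm (W x) (a x),
            real_inner_comm (b x) (W x), real_inner_comm (b x) (a x)]
          ring
        have i23 : Integrable fun x => 2 * (⟪a x, W x⟫_ℝ - ⟪W x, b x⟫_ℝ) := (i2.sub i3).const_mul 2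
        have i123 : Integrable fun x => ⟪a x - b x, a x - b x⟫_ℝ + 2 * (⟪a x, W x⟫_ℝ - ⟪W x, b x⟫_ℝ) := i1.add i23
        rw [this, integral_add i123 i4, integral_add i1 i23, integral_const_mul, integral_sub i2 i3]
      rw [hX, ih]
      ring
  obtain ⟨j, rfl⟩ := Nat.exists_eq_add_of_le hnm
  rw [key j]
  simp only [F, Finset.sum_range_add]
  have hb : ∀ k ∈ Finset.range j, -ip (D.incr (n + k)) (D.state n) ≤ D.eps (n + k) :=
    fun k _ => (neg_le_abs _).trans (D.abs_ip_incr_state_le (Nat.le_add_right n k))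
  have hs := Finset.sum_le_sum hb
  rw [Finset.sum_neg_distrib] at hs
  linarith

/-- **The states form a Cauchy sequence in `L²`** (monotone bounded corrected energies, as in the
tree's `ConvexIntegration.exists_forall_sub_lt_of_monotone`). [cite: ChoffrutSzekelyhidi2014, §2, Step 3] -/
theorem cauchy {η : ℝ} (hη : 0 < η) :
    ∃ M : ℕ, ∀ n m, M ≤ n → n ≤ m → ∫ x, ‖D.state m x - D.state n x‖ ^ 2 < η := by
  obtain ⟨M, hM⟩ := ConvexIntegration.exists_forall_sub_lt_of_monotone D.F_monotone D.F_le hη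
  refine ⟨M, fun n m hn hnm => ?_⟩
  have h := (D.ip_sub_le n m hnm).trans_lt (hM n m hn hnm)
  rwa [ip_self] at h

/-! ## The defects tend to zero -/

/-- The defect `J_k = ∫ (e - |v_k|²)` of the `k`-th state. [folklore] -/
def J (k : ℕ) : ℝ := defect D.e (D.state k)

/-- `J_k ≥ 0`. [folklore] -/
theorem J_nonneg (k : ℕ) : 0 ≤ D.J k := (D.state_memX0 k).defect_nonneg

/-- `J_k ≤ E_{k+1} - E_k + 3 ε_k`. [folklore] -/
theorem J_le (k : ℕ) : D.J k ≤ D.E (k + 1) - D.E k + 3 * D.eps k := by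
  rw [D.E_succ]
  have h1 := D.abs_ip_incr_state_le (le_refl k)
  rw [ip_comm] at h1
  have h2 := D.incr_gain k
  rw [← ip_self] at h2
  have := neg_abs_le (ip (D.state k) (D.incr k))
  unfold J; linarith

/-- **The defects are summable**: `Σ_{k<n} J_k ≤ R² + 3θ`. [cite: ChoffrutSzekelyhidi2014, §2, Step 3] -/
theorem sum_J_le (n : ℕ) : ∑ k ∈ Finset.range n, D.J k ≤ D.R ^ 2 + 3 * D.θ := by
  have h1 : ∑ k ∈ Finset.range n, D.J k ≤ ∑ k ∈ Finset.range n, (D.E (k + 1) - D.E k + 3 * D.eps k) :=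
    Finset.sum_le_sum fun k _ => D.J_le k
  rw [Finset.sum_add_distrib, Finset.sum_range_sub, ← Finset.mul_sum] at h1
  have h2 := D.E_le n
  have h3 : 0 ≤ D.E 0 := ip_self_nonneg _
  linarith [D.sum_eps_le (Finset.range n)]

/-- The defects are summable. [folklore] -/
theorem summable_J : Summable D.J :=
  summable_of_sum_range_le D.J_nonneg D.sum_J_le

/-- **The defects tend to zero.** [cite: ChoffrutSzekelyhidi2014, §2, Step 3] -/
theorem tendsto_J : Tendsto D.J atTop (𝓝 0) := D.summable_J.tendsto_atTop_zero

/-! ## The accumulated `H⁻¹` distance -/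

/-- **`‖v_k - v₀‖_{H⁻¹} ≤ Σ_{i<k} ε_i < θ`.** [cite: ChoffrutSzekelyhidi2014, Thm. 1 (the `H⁻¹` closeness)] -/
theorem eSobolevNorm_vel_state_sub_le (k : ℕ) :
    Torus.eSobolevNorm (-1) (EuclideanSpace.complexify ∘ fun x => vel (D.state k x) - vel (D.w₀ x)) ≤
      ENNReal.ofReal (∑ i ∈ Finset.range k, D.eps i) := by
  induction k with
  | zero =>
    simp only [D.state_zero, sub_self, Finset.range_zero, Finset.sum_empty, ENNReal.ofReal_zero, nonpos_iff_eq_zero]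
    have : (EuclideanSpace.complexify ∘ fun _ : UnitAddTorus d => (0 : Ed d)) = 0 := by
      funext x; simp
    rw [this]
    exact Torus.eSobolevNorm_zero_fun _
  | succ k ih =>
    have hsplit : (EuclideanSpace.complexify ∘ fun x => vel (D.state (k + 1) x) - vel (D.w₀ x)) =
        (EuclideanSpace.complexify ∘ fun x => vel (D.state k x) - vel (D.w₀ x)) +
          (EuclideanSpace.complexify ∘ fun x => vel (D.incr k x)) := by
      funext x
      simp only [comp_apply, Pi.add_apply, D.state_succ_apply, vel_add, ← map_add]
      congr 1; abel
    rw [hsplit, Finset.sum_range_succ, ENNReal.ofReal_add (Finset.sum_nonneg fun i _ => D.eps_nonneg i) (D.eps_nonneg k)]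
    refine (Torus.eSobolevNorm_add_le_holds ?_ ?_).trans (add_le_add ih (D.incr_hneg k))
    · exact (EuclideanSpace.continuous_complexify.comp ((continuous_vel.comp (D.state_continuous k)).sub
        (continuous_vel.comp D.hw₀.continuous))).integrable_unitAddTorus
    · exact (EuclideanSpace.continuous_complexify.comp (continuous_vel.comp (D.incr_continuous k))).integrable_unitAddTorus

end IterData

end StationaryEuler

end Literature.Analysis.FluidPDE
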